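import Summits.KontsevichZagierPeriods.KontsevichZagierPeriods.Theorems.TerasomaMultiplicationBetaCancellationStubWeightExists
import Literature.NumberTheory.Transcendental.KZFibredRelations

/-!
# `BetaCancellation` (stmt-KontsevichZagierPeriods-13633), line `dirichlet-companion-to-pi` — stub `stub_weightMul`

**The multiplier maps weight-preserving relations to relations.** Let `w : ℝ → ℝ` be a weight of
one real variable with `t ↦ w (t 0)` `ℚ`-semialgebraic on `ℝ¹`, such that every representation
`r = [t, f]` of dimension `k + 1 ≥ 1` has the weighted companion `[t, w (z 0) · f]`, and let
`M : FormalRep →+ FormalRep` be any additive endomorphism which kills the generators of dimension `0`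
and sends the generator `[r]` of a representation of dimension `k + 1` to `[s]` whenever `s` is the
weighted companion of `r` (same domain, integrand multiplied by `w (z 0)`). Then `M` maps the
subgroup generated by the *weight-preserving generators* — all domain- and integrand-additivity
instances (`KZ.domainAddRel`, `KZ.integrandAddRel`), the changes of variables `Φ` on
`(n+1)`-dimensional representations with `w (Φ x 0) = w (x 0)` on the domain, and the Newton–Leibniz
moves over a base of dimension `≥ 1` (`KZ.fibredNewtonLeibnizRel`) — into `KZ.relations`.

Proof. Generator by generator (`AddSubgroup.closure_le` for `relations.comap M`), exactly the
pattern of the wall restriction `wallRestrict_of_side` with "restrict the domain, same integrand"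
replaced by "same domain, integrand multiplied by `w (z 0)`": a weighted additivity instance is an
additivity instance (`weightMul_domainAddRel`, `weightMul_integrandAddRel`: multiply the pointwise
identities by `w (z 0)`; in dimension `0` the image is `0`); a weight-preserving change of variables
is a change of variables between the weighted companions, since
`w (x 0) · (f' (Φ x) · |det Φ' x|) = (w (Φ x 0) · f' (Φ x)) · |det Φ' x|`
(`weightMul_changeOfVariablesRel`); a Newton–Leibniz move over a base of dimension `≥ 1` becomes the
Newton–Leibniz move with primitive `w (z 0) · F z`, because the weight only depends on the base
coordinate `(Fin.snoc x t) 0 = x 0` and is therefore constant along each fibre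
(`weightMul_newtonLeibnizRel`; the new primitive is `ℚ`-semialgebraic as a product,
`IsSemialgebraicFunOn.mul_holds` with `weightExists_isSemialgebraicFunOn_coord`). `M` is evaluated
on generators through its two pinning hypotheses only. No definitions; sorry-free;
axioms ⊆ {propext, Classical.choice, Quot.sound}.

References: M. Kontsevich, D. Zagier, *Periods* (2001), §1.2 rules (1)–(3); J. Ayoub, *Une version
relative de la conjecture des périodes de Kontsevich–Zagier*, Ann. of Math. 181 (2015), §1.
-/

noncomputable section

-- `Summit.KontsevichZagierPeriods.KontsevichZagierPeriods.…` is the tree's mandated layout (single-conjunct summit).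
set_option linter.dupNamespace false

namespace Summit.KontsevichZagierPeriods.KontsevichZagierPeriods.BetaCancellationLine

open Set
open Literature.NumberTheory.Transcendental
open Literature.NumberTheory.Transcendental.KZ

/-! ### Multiplication by the weight preserves the weight-preserving generators -/

/-- Multiplying a domain-additivity instance `[r] − [r₁] − [r₂]` of dimension `≥ 1` by the weight
`w (z 0)` (same domains, each integrand multiplied by `w (z 0)`) gives a domain-additivity instance.
[cite: KontsevichZagier2001, §1.2 rule (1)] -/
theorem weightMul_domainAddRel {k : ℕ} (w : ℝ → ℝ) {r r₁ r₂ s s₁ s₂ : IntegralRep (k + 1)}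
    (hdom : r.domain = r₁.domain ∪ r₂.domain)
    (hnull : MeasureTheory.volume (r₁.domain ∩ r₂.domain) = 0)
    (h₁ : EqOn r.integrand r₁.integrand r₁.domain) (h₂ : EqOn r.integrand r₂.integrand r₂.domain)
    (hs : s.domain = r.domain) (hsi : s.integrand = fun z => w (z 0) * r.integrand z)
    (hs₁ : s₁.domain = r₁.domain) (hs₁i : s₁.integrand = fun z => w (z 0) * r₁.integrand z)
    (hs₂ : s₂.domain = r₂.domain) (hs₂i : s₂.integrand = fun z => w (z 0) * r₂.integrand z) :
    of s - of s₁ - of s₂ ∈ domainAddRel := by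
  refine ⟨k + 1, s, s₁, s₂, ?_, ?_, ?_, ?_, rfl⟩
  · rw [hs, hs₁, hs₂, hdom]
  · rw [hs₁, hs₂]
    exact hnull
  · rw [hsi, hs₁i, hs₁]
    intro z hz
    show w (z 0) * r.integrand z = w (z 0) * r₁.integrand z
    rw [h₁ hz]
  · rw [hsi, hs₂i, hs₂]
    intro z hz
    show w (z 0) * r.integrand z = w (z 0) * r₂.integrand z
    rw [h₂ hz]

/-- Multiplying an integrand-additivity instance `[r] − [r₁] − [r₂]` of dimension `≥ 1` by the
weight `w (z 0)` gives an integrand-additivity instance (`w · (f₁ + f₂) = w · f₁ + w · f₂`).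
[cite: KontsevichZagier2001, §1.2 rule (1)] -/
theorem weightMul_integrandAddRel {k : ℕ} (w : ℝ → ℝ) {r r₁ r₂ s s₁ s₂ : IntegralRep (k + 1)}
    (h₁ : r₁.domain = r.domain) (h₂ : r₂.domain = r.domain)
    (hadd : EqOn r.integrand (r₁.integrand + r₂.integrand) r.domain)
    (hs : s.domain = r.domain) (hsi : s.integrand = fun z => w (z 0) * r.integrand z)
    (hs₁ : s₁.domain = r₁.domain) (hs₁i : s₁.integrand = fun z => w (z 0) * r₁.integrand z)
    (hs₂ : s₂.domain = r₂.domain) (hs₂i : s₂.integrand = fun z => w (z 0) * r₂.integrand z) :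
    of s - of s₁ - of s₂ ∈ integrandAddRel := by
  refine ⟨k + 1, s, s₁, s₂, ?_, ?_, ?_, rfl⟩
  · rw [hs₁, hs, h₁]
  · rw [hs₂, hs, h₂]
  · rw [hsi, hs₁i, hs₂i, hs]
    intro z hz
    show w (z 0) * r.integrand z = w (z 0) * r₁.integrand z + w (z 0) * r₂.integrand z
    rw [hadd hz, Pi.add_apply, mul_add]

/-- **A weight-preserving change of variables is a change of variables between the weighted
companions**: with `w (Φ x 0) = w (x 0)` on `r.domain`,
`w (x 0) · f x = w (x 0) · (f' (Φ x) · |det Φ' x|) = (w (Φ x 0) · f' (Φ x)) · |det Φ' x|`; the map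
`Φ`, its derivative, injectivity and the image clause are unchanged.
[cite: KontsevichZagier2001, §1.2 rule (2)] -/
theorem weightMul_changeOfVariablesRel {k : ℕ} (w : ℝ → ℝ) {r r' s s' : IntegralRep (k + 1)}
    {Φ : (Fin (k + 1) → ℝ) → (Fin (k + 1) → ℝ)}
    {Φ' : (Fin (k + 1) → ℝ) → (Fin (k + 1) → ℝ) →L[ℝ] (Fin (k + 1) → ℝ)}
    (hΦ : IsSemialgebraicMapOn ℚ r.domain Φ)
    (hΦ' : ∀ x ∈ r.domain, HasFDerivWithinAt Φ (Φ' x) r.domain x) (hinj : InjOn Φ r.domain)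
    (hdom : r'.domain = Φ '' r.domain)
    (hf : ∀ x ∈ r.domain, r.integrand x = r'.integrand (Φ x) * |(Φ' x).det|)
    (hw' : ∀ x ∈ r.domain, w (Φ x 0) = w (x 0))
    (hs : s.domain = r.domain) (hsi : s.integrand = fun z => w (z 0) * r.integrand z)
    (hs' : s'.domain = r'.domain) (hs'i : s'.integrand = fun z => w (z 0) * r'.integrand z) :
    of s - of s' ∈ changeOfVariablesRel := by
  refine ⟨k + 1, s, s', Φ, Φ', ?_, ?_, ?_, ?_, fun x hx => ?_, rfl⟩
  · rw [hs]
    exact hΦ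
  · rw [hs]
    exact hΦ'
  · rw [hs]
    exact hinj
  · rw [hs', hs, hdom]
  · rw [hs] at hx
    rw [hsi, hs'i]
    show w (x 0) * r.integrand x = w (Φ x 0) * r'.integrand (Φ x) * |(Φ' x).det|
    rw [hf x hx, hw' x hx, mul_assoc]

/-- The first coordinate is a base coordinate of a band: `(Fin.snoc x t) 0 = x 0`. [folklore] -/
theorem weightMul_snoc_zero {n : ℕ} (x : Fin (n + 1) → ℝ) (t : ℝ) :
    (Fin.snoc x t : Fin (n + 2) → ℝ) 0 = x 0 := by
  show (Fin.snoc x t : Fin (n + 2) → ℝ) (Fin.castSucc 0) = x 0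
  exact Fin.snoc_castSucc (α := fun _ => ℝ) t x 0

/-- **Multiplying a Newton–Leibniz move over a base of dimension `≥ 1` by the weight gives a
Newton–Leibniz move**: the weight `w (z 0)` only depends on the base coordinate
`(Fin.snoc x t) 0 = x 0`, so it is constant along each fibre; the new primitive
`G z = w (z 0) · F z` is `ℚ`-semialgebraic on the band (product of semialgebraic functions),
fibrewise continuous with derivative `w (x 0) · f`, and its boundary values give
`w (x 0) · (F (x, b x) − F (x, a x))`. [cite: KontsevichZagier2001, §1.2 rule (3)] -/
theorem weightMul_newtonLeibnizRel {n : ℕ} {w : ℝ → ℝ}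
    (hw : IsSemialgebraicFunOn ℚ (Set.univ : Set (Fin 1 → ℝ)) (fun x => w (x 0)))
    {r s : IntegralRep (n + 2)} {r' s' : IntegralRep (n + 1)} {α β : (Fin (n + 1) → ℝ) → ℝ}
    {F : (Fin (n + 2) → ℝ) → ℝ}
    (hF : IsSemialgebraicFunOn ℚ r.domain F)
    (hα : IsSemialgebraicFunOn ℚ r'.domain α) (hβ : IsSemialgebraicFunOn ℚ r'.domain β)
    (hle : ∀ x ∈ r'.domain, α x ≤ β x)
    (hband : r.domain = {z | (Fin.init z : Fin (n + 1) → ℝ) ∈ r'.domain ∧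
      α (Fin.init z) ≤ z (Fin.last (n + 1)) ∧ z (Fin.last (n + 1)) ≤ β (Fin.init z)})
    (hcont : ∀ x ∈ r'.domain, ContinuousOn (fun t : ℝ => F (Fin.snoc x t)) (Icc (α x) (β x)))
    (hderiv : ∀ x ∈ r'.domain, ∀ t ∈ Ioo (α x) (β x),
      HasDerivAt (fun s : ℝ => F (Fin.snoc x s)) (r.integrand (Fin.snoc x t)) t)
    (hr' : ∀ x ∈ r'.domain, r'.integrand x = F (Fin.snoc x (β x)) - F (Fin.snoc x (α x)))
    (hs : s.domain = r.domain) (hsi : s.integrand = fun z => w (z 0) * r.integrand z)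
    (hs' : s'.domain = r'.domain) (hs'i : s'.integrand = fun z => w (z 0) * r'.integrand z) :
    of s - of s' ∈ newtonLeibnizRel := by
  have hG : IsSemialgebraicFunOn ℚ s.domain (fun z : Fin (n + 2) → ℝ => w (z 0) * F z) := by
    rw [hs]
    exact IsSemialgebraicFunOn.mul_holds
      ((weightExists_isSemialgebraicFunOn_coord hw (0 : Fin (n + 2))).mono (subset_univ _)
        r.isSemialgebraic_domain) hF
  refine ⟨n + 1, s, s', α, β, fun z => w (z 0) * F z, hG, ?_, ?_, ?_, ?_, ?_, ?_, ?_, rfl⟩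
  · rw [hs']
    exact hα
  · rw [hs']
    exact hβ
  · rw [hs']
    exact hle
  · rw [hs, hs', hband]
  · rw [hs']
    intro x hx
    simp only [weightMul_snoc_zero]
    exact (hcont x hx).const_smul (w (x 0))
  · rw [hs', hsi]
    intro x hx t ht
    simp only [weightMul_snoc_zero]
    exact (hderiv x hx t ht).const_mul (w (x 0))
  · rw [hs', hs'i]
    intro x hx
    show w (x 0) * r'.integrand x = w ((Fin.snoc x (β x) : Fin (n + 2) → ℝ) 0) * F (Fin.snoc x (β x)) -
      w ((Fin.snoc x (α x) : Fin (n + 2) → ℝ) 0) * F (Fin.snoc x (α x))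
    rw [weightMul_snoc_zero, weightMul_snoc_zero, hr' x hx, mul_sub]

/-! ### The multiplier maps weight-preserving relations to relations -/

/-- STUB (the multiplier maps weight-preserving relations to relations): for a `ℚ`-semialgebraic
weight `w` whose weighted companions exist, any additive `M` killing constants and pinned on
generators by `M [r] = [r.domain, w (z 0) · r.integrand]` maps the closure of the `w`-PRESERVING
generators — additivity, rule-(2) substitutions with `w (Φ x 0) = w (x 0)` on the domain,
Newton–Leibniz over bases of dimension `≥ 1` — into `relations`, generator by generator. [folklore] -/
theorem stub_weightMul :
    ∀ (w : ℝ → ℝ), IsSemialgebraicFunOn ℚ (Set.univ : Set (Fin 1 → ℝ)) (fun x => w (x 0)) →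
    (∀ (k : ℕ) (r : IntegralRep (k + 1)),
      ∃ s : IntegralRep (k + 1), s.domain = r.domain ∧ s.integrand = fun z => w (z 0) * r.integrand z) →
    ∀ (M : FormalRep →+ FormalRep),
      (∀ r : IntegralRep 0, M (of r) = 0) →
      (∀ (k : ℕ) (r s : IntegralRep (k + 1)), s.domain = r.domain →
          (s.integrand = fun z => w (z 0) * r.integrand z) → M (of r) = of s) →
      ∀ x ∈ AddSubgroup.closure (domainAddRel ∪ integrandAddRel ∪
          {x | ∃ (n : ℕ) (r r' : IntegralRep (n + 1)) (Φ : (Fin (n + 1) → ℝ) → (Fin (n + 1) → ℝ))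
              (Φ' : (Fin (n + 1) → ℝ) → (Fin (n + 1) → ℝ) →L[ℝ] (Fin (n + 1) → ℝ)),
            IsSemialgebraicMapOn ℚ r.domain Φ ∧
            (∀ x ∈ r.domain, HasFDerivWithinAt Φ (Φ' x) r.domain x) ∧ Set.InjOn Φ r.domain ∧
            r'.domain = Φ '' r.domain ∧
            (∀ x ∈ r.domain, r.integrand x = r'.integrand (Φ x) * |(Φ' x).det|) ∧
            (∀ x ∈ r.domain, w (Φ x 0) = w (x 0)) ∧
            x = of r - of r'} ∪
          fibredNewtonLeibnizRel),
        M x ∈ relations := by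
  intro w hw hex M h0 hpin x hx
  refine (AddSubgroup.closure_le (relations.comap M)).mpr ?_ hx
  rintro y (((hy | hy) | hy) | hy)
  · obtain ⟨k, r, r₁, r₂, hdom, hnull, h₁, h₂, rfl⟩ := hy
    rw [AddSubgroup.coe_comap, mem_preimage, map_sub, map_sub]
    cases k with
    | zero =>
      rw [h0 r, h0 r₁, h0 r₂, sub_zero, sub_zero]
      exact relations.zero_mem
    | succ k =>
      obtain ⟨s, hs, hsi⟩ := hex k r
      obtain ⟨s₁, hs₁, hs₁i⟩ := hex k r₁
      obtain ⟨s₂, hs₂, hs₂i⟩ := hex k r₂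
      rw [hpin k r s hs hsi, hpin k r₁ s₁ hs₁ hs₁i, hpin k r₂ s₂ hs₂ hs₂i]
      exact domainAddRel_subset_relations
        (weightMul_domainAddRel w hdom hnull h₁ h₂ hs hsi hs₁ hs₁i hs₂ hs₂i)
  · obtain ⟨k, r, r₁, r₂, h₁, h₂, hadd, rfl⟩ := hy
    rw [AddSubgroup.coe_comap, mem_preimage, map_sub, map_sub]
    cases k with
    | zero =>
      rw [h0 r, h0 r₁, h0 r₂, sub_zero, sub_zero]
      exact relations.zero_mem
    | succ k =>
      obtain ⟨s, hs, hsi⟩ := hex k r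
      obtain ⟨s₁, hs₁, hs₁i⟩ := hex k r₁
      obtain ⟨s₂, hs₂, hs₂i⟩ := hex k r₂
      rw [hpin k r s hs hsi, hpin k r₁ s₁ hs₁ hs₁i, hpin k r₂ s₂ hs₂ hs₂i]
      exact integrandAddRel_subset_relations
        (weightMul_integrandAddRel w h₁ h₂ hadd hs hsi hs₁ hs₁i hs₂ hs₂i)
  · obtain ⟨k, r, r', Φ, Φ', hΦ, hΦ', hinj, hdom, hf, hw', rfl⟩ := hy
    rw [AddSubgroup.coe_comap, mem_preimage, map_sub]
    obtain ⟨s, hs, hsi⟩ := hex k r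
    obtain ⟨s', hs', hs'i⟩ := hex k r'
    rw [hpin k r s hs hsi, hpin k r' s' hs' hs'i]
    exact changeOfVariablesRel_subset_relations
      (weightMul_changeOfVariablesRel w hΦ hΦ' hinj hdom hf hw' hs hsi hs' hs'i)
  · obtain ⟨k, r, r', α, β, F, hF, hα, hβ, hle, hband, hcont, hderiv, hr', rfl⟩ :=
      mem_fibredNewtonLeibnizRel_iff.mp hy
    rw [AddSubgroup.coe_comap, mem_preimage, map_sub]
    obtain ⟨s, hs, hsi⟩ := hex (k + 1) r
    obtain ⟨s', hs', hs'i⟩ := hex k r'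
    rw [hpin (k + 1) r s hs hsi, hpin k r' s' hs' hs'i]
    exact newtonLeibnizRel_subset_relations
      (weightMul_newtonLeibnizRel hw hF hα hβ hle hband hcont hderiv hr' hs hsi hs' hs'i)

end Summit.KontsevichZagierPeriods.KontsevichZagierPeriods.BetaCancellationLine

end
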